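import Literature.MathematicalPhysics.QuantumFieldTheory.Balaban1983to89.B9B8KnitLetterResolvent
import Literature.MathematicalPhysics.QuantumFieldTheory.Balaban1983to89.B9Thm37GpTorusRegular

/-!
# `Balaban1983to89.B9B8KnitLetterMajorantTransfer` — [B9] THM 3.1 (3.42)₁ AT THE KNIT LETTER FROM (3.42)₁ AT def-Y's LETTER: the block majorant
# `A·ℓ(y)²·e^{−δ₀d(y,y′)}` of `η²G′(U; parSymY)` passes to `η²G′(U; parKnitY)` as `A·c₁(α)(1 − θc₁(α))⁻¹·ℓ(y)²·e^{−(1−α)δ₀d(y,y′)}`,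
# `θ = O(α₀′)·A`, by the resolvent expansion of [4] (2.50)∕(2.66) (junction J-B file 9 — the sup-norm half of (E12) at print's own transporters,
# INHERITED from sub-row G-B9-LETTERS' M5.5 in its `conj b`∕`HasMajorant` currency)

statement-level skeleton of published theorems with citation tags; proofs where landed; nothing here is a claim about the
Yang–Mills mass gap

T. Bałaban, *Propagators for lattice gauge theories in a background field*, Commun. Math. Phys. **99** (1985) 389–434 [`Balaban1985BackgroundPropagators`,
"[B9]"]; T. Bałaban, *Propagators and renormalization transformations for lattice gauge theories. II*, Commun. Math. Phys. **96** (1984) 223–250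
[`Balaban1984PropagatorsII`, "[4]"]; T. Bałaban, *Averaging operations for lattice gauge theories*, Commun. Math. Phys. **98** (1985) 17–51
[`Balaban1985Averaging`, "[B7]"]; T. Bałaban, *Spaces of regular gauge field configurations on a lattice and gauge fixing conditions*, Commun. Math. Phys.
**99** (1985) 75–102 [`Balaban1985RegularSpaces`, "[B8]"].

THE PRINT.  [B9] Thm 3.1 (3.42)₁ p. 397: *«|(G′(U)λ)(x)| ≦ B₀(Lʲη)²e^{−δ₀d(y,y′)}|λ| for x ∈ Δ(y), supp λ ⊂ Δ(y′)»*, `G′(U) = Δ′_a(U)⁻¹` with the averaging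
operators of (3.19) p. 393 at the composite contours *«(52), (53) in [5]»* — the knit letter.  [4] p. 234 (2.66) ∕ [B9] p. 409–410 (3.90): *«G′ = G′₀(I − R′)⁻¹
= Σ_n G′₀R′ⁿ … The expansion is convergent in all norms appearing in the inequalities (3.42)–(3.47)»* — with `G′₀ := G′(U; parSymY)` (def-Y's letter of
record, where M5.5 `B9Thm37GpTorusRegular*` proves (3.42)₁ by Thm 3.7) and `R′ := (Δ′_sym − Δ′_knit)G′(U; parSymY)` (junction file 8: block-diagonal of size
`32(d+1)²α₀′L^{−2k}`), r03-lineage's kernel-checked summation `B6RandomWalk.majorant_of_fixedPoint_266` IS this sentence.  [B8] (1.101) p. 93 is the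
consumer's (E12).

WHY THIS FILE ∕ THE ARGUMENT.  File 8's resolvent identity `G′_knit = G′_sym + G′_knit∘E∘G′_sym` is, after multiplication by `η²` and realification `conj b`
(p21's (2.51) coordinates, `B9Eq352DivFormLetters`), a fixed-point identity `G′ = G′₀ + G′·R′` with `R′ = conj b(η⁻²E)·conj b(η²G′_sym)`; `conj b(η⁻²E)` has the
block-DIAGONAL majorant `η⁻²·32(d+1)²α₀′L^{−2k}·M₂Σ‖b_j‖·𝟙[y = y′]` (`hasMajorant_conj_of_local'` on file 8's `norm_deltaPrimeAY_sub_apply_le`), so `R′` has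
the majorant `θ·e^{−δ₀d}` with `θ = η⁻²·32(d+1)²α₀′L^{−2k}·M₂Σ‖b_j‖·A·P_max`; in print's units `η = L^{−k}`, `ℓ(y) = L^{j(y)}η ≤ 1`, this is
`θ = 32(d+1)²α₀′·M₂Σ‖b_j‖·A` — LEVEL- AND VOLUME-FREE, small with `α₀′`.

CITATION HEADER (lean-in-tree rule).  Cell `lit-balaban`, sub-row G-B9-LETTERS, junction J-B (lead RULINGS #3–#4; RULING #4 (ii)) file 9 → seat `lit-balaban-p33`
gen 94.  REUSED BY NAME: r03∕p21-lineage `B6RandomWalk.majorant_of_fixedPoint_266`, `hasMajorant_mul`, `hasMajorant_mono`; p21's `B9Eq352DivFormLetters.conj`,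
`conj_mul`, `hasMajorant_conj_of_local'`, `B9Thm37GpTorusRegular.conj_smul` (M5.5 FILE 1, whose `hasMajorant_conj_Gp_of_cubes` output is this file's
displayed hypothesis `hGs`); junction file 8 (`GpY_parKnitY_eq'`, `norm_deltaPrimeAY_sub_apply_le`), file 4b (`parKnitY_mem_of_pdev`).

WHAT THIS FILE PROVES (sorry-free; no definitions; the majorant at def-Y's letter is a DISPLAYED HYPOTHESIS, nothing of [B9] asserted).
* §1 ★ `hasMajorant_conj_smul_sub`: `conj b (c•E)` has the block-diagonal majorant `|c|·32(d+1)²α₀′(L^k)⁻²·(M₂Σ‖b_j‖)·𝟙[y = y′]` on the class (52).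
* §2 `conj_fixedPoint` (the realified fixed-point identity), ★★★ **`hasMajorant_conj_GpY_parKnitY_of_parSymY`**: `G ≤ U(N)` averaging-closed, `N ≥ 1`,
  `G`-valued `U` with `pdev (liftCfg U) < α₀′(L^k)⁻²` (`0 < α₀′`, `C₀α₀′ ≤ ⅓`, `2α₀′ ≤ c₂′`); a real basis `b` with `|b.repr v j| ≤ M₂‖v‖`; the member's
  geometry inputs (2.54), `d(y,y) = 0`, `d ≥ 0`, (2.61), (2.63) at `(δ₀, α)`; `0 ≤ A`, `0 ≤ P ≤ P_max`; the DISPLAYED (3.42)₁ majorant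
  `A·P(y)·e^{−δ₀d}` of `conj b (η²G′(U; parSymY))`; `θ := (η²)⁻¹·32(d+1)²α₀′(L^k)⁻²·M₂Σ‖b_j‖·A·P_max` with `θc₁(α) < 1`  ⟹  `conj b (η²G′(U; parKnitY))`
  has the majorant `A·c₁(α)(1 − θc₁(α))⁻¹·P(y)·e^{−(1−α)δ₀d(y,y′)}`.
* §3 print's units: `inv_etaS_sq_mul` (`(η²)⁻¹(L^k)⁻² = 1` at `η = etaS i`), `geo9K_len_sq_le_one` (`ℓ(y)² ≤ 1` when `c_f = L^k`), ★★★
  **`hasMajorant_conj_GpY_parKnitY_of_parSymY_len`**: the same with `P = ℓ²`, `η = etaS i`, `c_f = L^k` and `θ = 32(d+1)²α₀′·M₂Σ‖b_j‖·A`.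

HONEST SCOPE.  A transfer under a displayed hypothesis (supplier: M5.5 at def-Y's letter, then M5.3's `hinv`); constants explicit; the rate loses the factor
`(1−α)` of [4] Lemma 2.1 exactly as print's p. 410 «decay rate arbitrarily close»; the gradient∕Hölder∕`L²` companions (3.42)₂–(3.46) are not transferred here
(the `L²` ones are junction file 7); the (52) hypothesis on the lift is carried explicitly (file 4b's header).  Count-neutral; nothing continuum, nothing
about OS axioms or the mass gap.  No `sorry`, no `axiom`, no `instance`, no `notation`.  NEW file; nothing landed is modified.  Net new unproved facts: 0.
Seat `lit-balaban-p33` gen 94, 2026-08-28.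
-/

noncomputable section

namespace Literature.MathematicalPhysics.QuantumFieldTheory.Balaban1983to89.B9B8KnitLetterMajorantTransfer

open Node00 B6KLevelCensusIndexV1 B6Geom246MultiLevelBox B9BackgroundsKLevelV1 B9Eq39Adjoint B9Thm311ReadingCoords B9Thm311DeltaPrimePos
open B6RandomWalk (HasMajorant Triangle254 Ineq261 Ineq263 hasMajorant_mono hasMajorant_mul majorant_of_fixedPoint_266 c1_nonneg)
open B9Thm34Ext (toB6)
open B9GeoNormsKLevelV1 (geo9K geo9K_len_kGeo)
open B9Eq352DivFormLetters (coordEquiv conj conj_apply hasMajorant_conj_of_local')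
open B9Thm37GpTorusRegular (conj_smul)
open B6Prop22KLevelTorusCensusEta (nKT)
open B9Ineq349SiteComposite (etaS_pos)
open B7Prop2Explicit (AvgClosed pdev C0 c2')
open B9B8CarrierDictionary (liftCfg)
open B9B8AveragingJunction (parKnitY parKnitY_inv)
open B9B8KnitLetterRegular (parKnitY_mem_of_pdev)
open B9B8KnitLetterResolvent (GpY_parKnitY_eq' norm_deltaPrimeAY_sub_apply_le)
open scoped Matrix Matrix.Norms.L2Operator

variable {d ℓ : ℕ} {hd : 1 ≤ d + 1} {hL : Odd (ℓ + 1) ∧ 1 < ℓ + 1} {b₀ b₁ : ℝ}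
variable (i : KIdx d ℓ hd hL b₀ b₁) {N : ℕ} {G : Subgroup (Matrix (Fin N) (Fin N) ℂ)ˣ}
variable {ι : Type} [Fintype ι] [DecidableEq ι] (b : Module.Basis ι ℝ (Matrix (Fin N) (Fin N) ℂ))
variable [Fintype (geo9K i).Site] [DecidableEq (geo9K i).Site] {Rr : ℝ} {Hp : Prop} (ιB : BlkY i → IBondY i)

/-! ## §1 The block-diagonal majorant of the realified difference operator -/

omit [DecidableEq ι] in
/-- ★ **`conj b (c·E)` IS BLOCK-DIAGONAL AND SMALL**: for `G ≤ U(N)` averaging-closed, `N ≥ 1`, a `G`-valued `U` on [B7]'s class (52) and a real basis `b` with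
`|b.repr v j| ≤ M₂‖v‖`, the realification of `c·(Δ′_a(U; parSymY) − Δ′_a(U; parKnitY))` has the majorant `|c|·32(d+1)²α₀′(L^k)⁻²·(M₂Σ_j‖b_j‖)·𝟙[y = y′]`
w.r.t. `(z, j) ↦ ιB(Δ(z))`. [cite: Balaban1984PropagatorsII, (2.51) p.232; Balaban1985BackgroundPropagators, (3.24) p.394, (3.19) p.393; Balaban1985Averaging, (52)–(53) pp.26–27] -/
theorem hasMajorant_conj_smul_sub [Nonempty (Fin N)] (hG : G ≤ B7Prop2Explicit.unitaryUnits (Matrix (Fin N) (Fin N) ℂ))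
    (hGa : AvgClosed (d + 1) (ℓ + 1) G) {U : CfgY (Matrix (Fin N) (Fin N) ℂ) i} (hU : ∀ μ x, U μ x ∈ G)
    {α₀' : ℝ} (hα : 0 < α₀') (hα3 : C0 (d + 1) * α₀' ≤ 1 / 3) (hα2 : 2 * α₀' ≤ c2' (d + 1) (ℓ + 1))
    (h52 : pdev (liftCfg U) < α₀' * ((((ℓ + 1 : ℕ) : ℝ) ^ i.k)⁻¹) ^ 2)
    {M₂ : ℝ} (hM₂ : 0 ≤ M₂) (hrepr : ∀ (v : Matrix (Fin N) (Fin N) ℂ) (j : ι), |b.repr v j| ≤ M₂ * ‖v‖) (c : ℝ) :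
    HasMajorant (g := toB6 (geo9K i) Rr Hp) (fun p : SiteY i × ι => ιB (blkOf i.D.toDomains p.1))
      (conj b (c • (deltaPrimeAY i (parSymY i) U - deltaPrimeAY i (parKnitY i) U).restrictScalars ℝ))
      (fun a a' : (geo9K i).Site => if a = a' then |c| * (32 * ((d : ℝ) + 1) ^ 2 * α₀' * (((((ℓ + 1) ^ i.k : ℕ) : ℝ)) ^ 2)⁻¹) * (M₂ * ∑ j, ‖b j‖) else 0) := by
  refine hasMajorant_conj_of_local' b (g := geo9K i) (Rr := Rr) (H := Hp) (fun z : SiteY i => ιB (blkOf i.D.toDomains z))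
    (fun z w : SiteY i => blkOf i.D.toDomains w = blkOf i.D.toDomains z)
    (fun _ => |c| * (32 * ((d : ℝ) + 1) ^ 2 * α₀' * (((((ℓ + 1) ^ i.k : ℕ) : ℝ)) ^ 2)⁻¹)) M₂ hM₂ hrepr (fun z w h => congrArg ιB h) _ ?_
  intro f x B hB
  have hB0 : 0 ≤ B := (norm_nonneg _).trans (hB x rfl)
  have hE := norm_deltaPrimeAY_sub_apply_le i hG hGa hU hα hα3 hα2 h52 f x hB0 (fun w hw => hB w hw)
  rw [LinearMap.smul_apply, Pi.smul_apply, LinearMap.restrictScalars_apply, LinearMap.sub_apply, ← Complex.coe_smul, norm_smul, Complex.norm_real,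
    Real.norm_eq_abs, mul_assoc]
  exact mul_le_mul_of_nonneg_left hE (abs_nonneg c)

/-! ## §2 The transfer of the (3.42)₁ majorant -/

/-- a diagonal kernel composed with any kernel: `Σ_y 𝟙[a = y]κ·f(y) = κ·f(a)`. [cite: Balaban1984PropagatorsII, (2.52) p.232, bookkeeping] -/
theorem sum_ite_eq_mul {S : Type} [Fintype S] [DecidableEq S] (a : S) (κ : ℝ) (f : S → ℝ) :
    ∑ y, (if a = y then κ else 0) * f y = κ * f a := by
  rw [Finset.sum_eq_single a (fun y _ hy => by rw [if_neg (Ne.symm hy), zero_mul]) (fun h => (h (Finset.mem_univ a)).elim), if_pos rfl]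

omit [DecidableEq ι] [Fintype (geo9K i).Site] [DecidableEq (geo9K i).Site] in
/-- THE REALIFIED FIXED-POINT IDENTITY: with `E = Δ′_sym − Δ′_knit` and `η ≠ 0`,
`conj b(η²G′_knit) = conj b(η²G′_sym) + conj b(η²G′_knit)·(conj b(η⁻²E)·conj b(η²G′_sym))` (`G`-valued `U` and knit legs, `G ≤ U(N)`).
[cite: Balaban1984PropagatorsII, (2.50) p.232, (2.52) p.232; Balaban1985BackgroundPropagators, (3.90) p.409] -/
theorem conj_fixedPoint (hG : G ≤ B7Prop2Explicit.unitaryUnits (Matrix (Fin N) (Fin N) ℂ)) {U : CfgY (Matrix (Fin N) (Fin N) ℂ) i}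
    (hU : ∀ μ x, U μ x ∈ G) (hpar : ∀ z w : SiteY i, parKnitY i U z w ∈ G) {η : ℝ} (hη : η ≠ 0) :
    conj b ((η ^ 2) • (GpY i (parKnitY i) U).restrictScalars ℝ)
      = conj b ((η ^ 2) • (GpY i (parSymY i) U).restrictScalars ℝ)
        + conj b ((η ^ 2) • (GpY i (parKnitY i) U).restrictScalars ℝ)
          * (conj b ((η ^ 2)⁻¹ • (deltaPrimeAY i (parSymY i) U - deltaPrimeAY i (parKnitY i) U).restrictScalars ℝ)
            * conj b ((η ^ 2) • (GpY i (parSymY i) U).restrictScalars ℝ)) := by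
  set Gk : Module.End ℝ (SiteY i → Matrix (Fin N) (Fin N) ℂ) := (GpY i (parKnitY i) U).restrictScalars ℝ with hGk
  set Gs : Module.End ℝ (SiteY i → Matrix (Fin N) (Fin N) ℂ) := (GpY i (parSymY i) U).restrictScalars ℝ with hGs
  set E : Module.End ℝ (SiteY i → Matrix (Fin N) (Fin N) ℂ) := (deltaPrimeAY i (parSymY i) U - deltaPrimeAY i (parKnitY i) U).restrictScalars ℝ with hE
  have hη2 : (η ^ 2 : ℝ) ≠ 0 := pow_ne_zero 2 hη
  -- the resolvent identity of file 8, restricted to real scalars (all `restrictScalars` lemmas are `rfl`)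
  have hfixℝ : Gk = Gs + Gk * E * Gs := congrArg (LinearMap.restrictScalars ℝ) (GpY_parKnitY_eq' i hG hU hpar)
  have hprod : ((η ^ 2)⁻¹ • E) * ((η ^ 2) • Gs) = E * Gs := by
    rw [smul_mul_assoc, mul_smul_comm, smul_smul, inv_mul_cancel₀ hη2, one_smul]
  have key : (η ^ 2) • Gk = (η ^ 2) • Gs + ((η ^ 2) • Gk) * (((η ^ 2)⁻¹ • E) * ((η ^ 2) • Gs)) := by
    rw [hprod, smul_mul_assoc, ← mul_assoc, ← smul_add]
    exact congrArg ((η ^ 2) • ·) hfixℝ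
  have hadd : ∀ T₁ T₂ : Module.End ℝ (SiteY i → Matrix (Fin N) (Fin N) ℂ), conj b (T₁ + T₂) = conj b T₁ + conj b T₂ := fun T₁ T₂ => by
    simp only [B9Eq352DivFormLetters.conj, map_add]
  conv_lhs => rw [key]
  rw [hadd, B9Eq352DivFormLetters.conj_mul, B9Eq352DivFormLetters.conj_mul]

/-- ★★★ **[B9] THM 3.1 (3.42)₁ AT THE KNIT LETTER, FROM (3.42)₁ AT def-Y's LETTER OF RECORD.**  For `G ≤ U(N)` averaging-closed, `N ≥ 1`, a `G`-valued `U`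
with `pdev (liftCfg U) < α₀′(L^k)⁻²` (`0 < α₀′`, `C₀α₀′ ≤ ⅓`, `2α₀′ ≤ c₂′`); a real basis `b` of `M_N(ℂ)` with `|b.repr v j| ≤ M₂‖v‖`; the member's geometry
inputs ((2.54), `d(y,y) = 0`, `d ≥ 0`, (2.61)∕(2.63) at `(δ₀, α)`, `(1−α)δ₀ ≥ 0`); weights `0 ≤ A`, `0 ≤ P(y) ≤ P_max`; `η ≠ 0`; the DISPLAYED (3.42)₁ block
majorant `A·P(y)·e^{−δ₀d(y,y′)}` of `conj b (η²·G′(U; parSymY))` w.r.t. `(z, j) ↦ ιB(Δ(z))`; and the smallness `θ·c₁(α) < 1` for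
`θ = (η²)⁻¹·32(d+1)²α₀′(L^k)⁻²·(M₂Σ_j‖b_j‖)·A·P_max`.  THEN `conj b (η²·G′(U; parKnitY))` has the block majorant
`A·c₁(α)·(1 − θc₁(α))⁻¹·P(y)·e^{−(1−α)δ₀d(y,y′)}` — print's (3.42)₁ at its own transporters, constant and rate degraded exactly as in [4] (2.66).
[cite: Balaban1985BackgroundPropagators, Thm 3.1 (3.42) p.397, (3.19) p.393, Thm 3.7 (3.90) pp.409–410; Balaban1984PropagatorsII, Prop. 2.2 (2.50)–(2.51) p.232, (2.66)–(2.67) p.234; Balaban1985Averaging, (52)–(53) pp.26–27] -/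
theorem hasMajorant_conj_GpY_parKnitY_of_parSymY [Nonempty (Fin N)] (hG : G ≤ B7Prop2Explicit.unitaryUnits (Matrix (Fin N) (Fin N) ℂ))
    (hGa : AvgClosed (d + 1) (ℓ + 1) G) {U : CfgY (Matrix (Fin N) (Fin N) ℂ) i} (hU : ∀ μ x, U μ x ∈ G)
    {α₀' : ℝ} (hα : 0 < α₀') (hα3 : C0 (d + 1) * α₀' ≤ 1 / 3) (hα2 : 2 * α₀' ≤ c2' (d + 1) (ℓ + 1))
    (h52 : pdev (liftCfg U) < α₀' * ((((ℓ + 1 : ℕ) : ℝ) ^ i.k)⁻¹) ^ 2)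
    {M₂ : ℝ} (hM₂ : 0 ≤ M₂) (hrepr : ∀ (v : Matrix (Fin N) (Fin N) ℂ) (j : ι), |b.repr v j| ≤ M₂ * ‖v‖)
    (d' : ℕ) {δ₀ α A Pmax : ℝ} {P : (geo9K i).Site → ℝ} (hA : 0 ≤ A) (hP : ∀ y, 0 ≤ P y) (hPmax : ∀ y, P y ≤ Pmax)
    (hαδ : 0 ≤ (1 - α) * δ₀) (htri : Triangle254 (toB6 (geo9K i) Rr Hp)) (hrefl : ∀ y : (geo9K i).Site, (geo9K i).dist y y = 0)
    (hdnn : ∀ y y' : (geo9K i).Site, 0 ≤ (geo9K i).dist y y')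
    (h261 : Ineq261 d' (toB6 (geo9K i) Rr Hp) δ₀ α) (h263 : Ineq263 d' (toB6 (geo9K i) Rr Hp) δ₀ α)
    {η : ℝ} (hη : η ≠ 0)
    (hsmall : ((η ^ 2)⁻¹ * (32 * ((d : ℝ) + 1) ^ 2 * α₀' * (((((ℓ + 1) ^ i.k : ℕ) : ℝ)) ^ 2)⁻¹) * (M₂ * ∑ j, ‖b j‖) * A * Pmax)
      * B6.c1 d' δ₀ α < 1)
    (hGs : HasMajorant (g := toB6 (geo9K i) Rr Hp) (fun p : SiteY i × ι => ιB (blkOf i.D.toDomains p.1))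
      (conj b ((η ^ 2) • (GpY i (parSymY i) U).restrictScalars ℝ))
      (fun a a' => A * P a * Real.exp (-(δ₀ * (geo9K i).dist a a')))) :
    HasMajorant (g := toB6 (geo9K i) Rr Hp) (fun p : SiteY i × ι => ιB (blkOf i.D.toDomains p.1))
      (conj b ((η ^ 2) • (GpY i (parKnitY i) U).restrictScalars ℝ))
      (fun a a' => A * B6.c1 d' δ₀ α
          * (1 - ((η ^ 2)⁻¹ * (32 * ((d : ℝ) + 1) ^ 2 * α₀' * (((((ℓ + 1) ^ i.k : ℕ) : ℝ)) ^ 2)⁻¹) * (M₂ * ∑ j, ‖b j‖) * A * Pmax)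
              * B6.c1 d' δ₀ α)⁻¹
          * P a * Real.exp (-((1 - α) * δ₀ * (geo9K i).dist a a'))) := by
  have hparK : ∀ z w : SiteY i, parKnitY i U z w ∈ G := fun z w => parKnitY_mem_of_pdev i hGa hU hα hα3 hα2 h52 z w
  set ε : ℝ := 32 * ((d : ℝ) + 1) ^ 2 * α₀' * (((((ℓ + 1) ^ i.k : ℕ) : ℝ)) ^ 2)⁻¹ with hεdef
  set κ₀ : ℝ := (η ^ 2)⁻¹ * ε * (M₂ * ∑ j, ‖b j‖) with hκ₀def
  set θ : ℝ := κ₀ * A * Pmax with hθdef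
  have hε0 : 0 ≤ ε := by positivity
  have hSb : 0 ≤ ∑ j, ‖b j‖ := Finset.sum_nonneg fun _ _ => norm_nonneg _
  have hκ₀0 : 0 ≤ κ₀ := by positivity
  have hPmax0 : 0 ≤ Pmax := le_trans (hP (ιB (blkOf i.D.toDomains (toKT i).origin))) (hPmax _)
  have hθ0 : 0 ≤ θ := by positivity
  -- the remainder `R′ = conj b(η⁻²E)·conj b(η²G′_sym)` and its majorant `θ·e^{−δ₀d}`
  have hEmaj := hasMajorant_conj_smul_sub i b ιB (Rr := Rr) (Hp := Hp) hG hGa hU hα hα3 hα2 h52 hM₂ hrepr ((η ^ 2)⁻¹)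
  have habs : |(η ^ 2)⁻¹| = (η ^ 2)⁻¹ := abs_of_nonneg (inv_nonneg.2 (sq_nonneg η))
  have hK₂ : ∀ a a' : (geo9K i).Site, 0 ≤ A * P a * Real.exp (-(δ₀ * (geo9K i).dist a a')) := fun a a' =>
    mul_nonneg (mul_nonneg hA (hP a)) (Real.exp_nonneg _)
  have hR : HasMajorant (g := toB6 (geo9K i) Rr Hp) (fun p : SiteY i × ι => ιB (blkOf i.D.toDomains p.1))
      (conj b ((η ^ 2)⁻¹ • (deltaPrimeAY i (parSymY i) U - deltaPrimeAY i (parKnitY i) U).restrictScalars ℝ)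
        * conj b ((η ^ 2) • (GpY i (parSymY i) U).restrictScalars ℝ))
      (fun a a' => θ * Real.exp (-(δ₀ * (geo9K i).dist a a'))) := by
    refine hasMajorant_mono _ (hasMajorant_mul _ hEmaj hGs hK₂) fun a a' => ?_
    have hsum := sum_ite_eq_mul (S := (geo9K i).Site) a (|(η ^ 2)⁻¹| * ε * (M₂ * ∑ j, ‖b j‖))
      (fun y'' => A * P y'' * Real.exp (-(δ₀ * (geo9K i).dist y'' a')))
    refine (le_of_eq hsum).trans ?_
    rw [habs]
    have he : 0 ≤ Real.exp (-(δ₀ * (geo9K i).dist a a')) := Real.exp_nonneg _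
    calc κ₀ * (A * P a * Real.exp (-(δ₀ * (geo9K i).dist a a')))
        ≤ κ₀ * (A * Pmax * Real.exp (-(δ₀ * (geo9K i).dist a a'))) :=
          mul_le_mul_of_nonneg_left (mul_le_mul_of_nonneg_right (mul_le_mul_of_nonneg_left (hPmax a) hA) he) hκ₀0
      _ = θ * Real.exp (-(δ₀ * (geo9K i).dist a a')) := by rw [hθdef]; ring
  have hfix := conj_fixedPoint i b hG hU hparK hη
  exact majorant_of_fixedPoint_266 (fun p : SiteY i × ι => ιB (blkOf i.D.toDomains p.1)) d' δ₀ α θ A P hA hP hθ0 hαδ htri hrefl hdnn h261 h263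
    hsmall hGs hR hfix

/-! ## §3 Print's units: `η = L^{−k}`, `c_f = L^k`, `ℓ(y) = L^{j(y)}η ≤ 1` -/

omit [Fintype (geo9K i).Site] [DecidableEq (geo9K i).Site] in
/-- at `η = etaS i = (L^k)⁻¹`: `(η²)⁻¹·(L^k)⁻² = 1` — file 8's lattice-unit smallness is `O(α₀′)` in print's units.
[cite: Balaban1984PropagatorsII, (2.1) p.224 («η = L^{−k}»), bookkeeping] -/
theorem inv_etaS_sq_mul : ((etaS i) ^ 2)⁻¹ * (((((ℓ + 1) ^ i.k : ℕ) : ℝ)) ^ 2)⁻¹ = 1 := by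
  have hk : nKT (toKT i) = (ℓ + 1) ^ i.k := rfl
  unfold etaS
  rw [hk, inv_pow, inv_inv, mul_inv_cancel₀ (pow_ne_zero 2 (by positivity))]

omit [Fintype (geo9K i).Site] [DecidableEq (geo9K i).Site] in
/-- in print's units `c_f = L^k` the block scale of the member's geometry is at most one: `ℓ(y)² ≤ 1` (`ℓ(y) = L^{j(y)}∕|c_f|`, `j(y) ≤ k`).
[cite: Balaban1984PropagatorsII, (2.1) p.224; Balaban1985BackgroundPropagators, (3.41) p.397 («Lʲη»)] -/
theorem geo9K_len_sq_le_one (hcf : i.cf = (((ℓ + 1 : ℕ) : ℝ)) ^ i.k) (y : (geo9K i).Site) : (geo9K i).len y ^ 2 ≤ 1 := by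
  have hlen : (geo9K i).len y = (((ℓ + 1 : ℕ) : ℝ)) ^ (B6Ineq2142KLevelV1.lvl i.hN i.D i.hk y) / |i.cf| := by
    rw [geo9K_len_kGeo]; exact len_eq i y
  have hL1 : (1 : ℝ) ≤ ((ℓ + 1 : ℕ) : ℝ) := by exact_mod_cast Nat.succ_le_succ (Nat.zero_le ℓ)
  have hpos : (0 : ℝ) < (((ℓ + 1 : ℕ) : ℝ)) ^ i.k := by positivity
  have hle : (geo9K i).len y ≤ 1 := by
    rw [hlen, hcf, abs_of_pos hpos, div_le_one hpos]
    exact pow_le_pow_right₀ hL1 (B6Ineq2142KLevelV1.lvl_le i.hN i.D i.hk y)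
  have h0 : 0 ≤ (geo9K i).len y := by rw [hlen]; positivity
  nlinarith

/-- ★★★ **(3.42)₁ AT THE KNIT LETTER IN PRINT's UNITS** (`η = etaS i = L^{−k}`, `c_f = L^k`, `P = ℓ²`): under the hypotheses of
`hasMajorant_conj_GpY_parKnitY_of_parSymY` with the displayed majorant `A·ℓ(y)²·e^{−δ₀d}` of `conj b (η²G′(U; parSymY))` — the OUTPUT SHAPE of M5.5's
`B9Thm37GpTorusRegular.hasMajorant_conj_Gp_of_cubes` — and `θ = 32(d+1)²α₀′·(M₂Σ_j‖b_j‖)·A` with `θc₁(α) < 1`:  `conj b (η²G′(U; parKnitY))` has the majorant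
`A·c₁(α)(1 − θc₁(α))⁻¹·ℓ(y)²·e^{−(1−α)δ₀d(y,y′)}`. [cite: Balaban1985BackgroundPropagators, Thm 3.1 (3.42) p.397, (3.19) p.393, Thm 3.7 (3.90) pp.409–410; Balaban1984PropagatorsII, (2.66)–(2.67) p.234; Balaban1985RegularSpaces, (1.101) p.93] -/
theorem hasMajorant_conj_GpY_parKnitY_of_parSymY_len [Nonempty (Fin N)] (hG : G ≤ B7Prop2Explicit.unitaryUnits (Matrix (Fin N) (Fin N) ℂ))
    (hGa : AvgClosed (d + 1) (ℓ + 1) G) {U : CfgY (Matrix (Fin N) (Fin N) ℂ) i} (hU : ∀ μ x, U μ x ∈ G)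
    {α₀' : ℝ} (hα : 0 < α₀') (hα3 : C0 (d + 1) * α₀' ≤ 1 / 3) (hα2 : 2 * α₀' ≤ c2' (d + 1) (ℓ + 1))
    (h52 : pdev (liftCfg U) < α₀' * ((((ℓ + 1 : ℕ) : ℝ) ^ i.k)⁻¹) ^ 2) (hcf : i.cf = (((ℓ + 1 : ℕ) : ℝ)) ^ i.k)
    {M₂ : ℝ} (hM₂ : 0 ≤ M₂) (hrepr : ∀ (v : Matrix (Fin N) (Fin N) ℂ) (j : ι), |b.repr v j| ≤ M₂ * ‖v‖)
    (d' : ℕ) {δ₀ α A : ℝ} (hA : 0 ≤ A) (hαδ : 0 ≤ (1 - α) * δ₀) (htri : Triangle254 (toB6 (geo9K i) Rr Hp))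
    (hrefl : ∀ y : (geo9K i).Site, (geo9K i).dist y y = 0) (hdnn : ∀ y y' : (geo9K i).Site, 0 ≤ (geo9K i).dist y y')
    (h261 : Ineq261 d' (toB6 (geo9K i) Rr Hp) δ₀ α) (h263 : Ineq263 d' (toB6 (geo9K i) Rr Hp) δ₀ α)
    (hsmall : (32 * ((d : ℝ) + 1) ^ 2 * α₀' * (M₂ * ∑ j, ‖b j‖) * A) * B6.c1 d' δ₀ α < 1)
    (hGs : HasMajorant (g := toB6 (geo9K i) Rr Hp) (fun p : SiteY i × ι => ιB (blkOf i.D.toDomains p.1))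
      (conj b ((etaS i ^ 2) • (GpY i (parSymY i) U).restrictScalars ℝ))
      (fun a a' => A * (geo9K i).len a ^ 2 * Real.exp (-(δ₀ * (geo9K i).dist a a')))) :
    HasMajorant (g := toB6 (geo9K i) Rr Hp) (fun p : SiteY i × ι => ιB (blkOf i.D.toDomains p.1))
      (conj b ((etaS i ^ 2) • (GpY i (parKnitY i) U).restrictScalars ℝ))
      (fun a a' => A * B6.c1 d' δ₀ α * (1 - (32 * ((d : ℝ) + 1) ^ 2 * α₀' * (M₂ * ∑ j, ‖b j‖) * A) * B6.c1 d' δ₀ α)⁻¹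
          * (geo9K i).len a ^ 2 * Real.exp (-((1 - α) * δ₀ * (geo9K i).dist a a'))) := by
  have hθ : (etaS i ^ 2)⁻¹ * (32 * ((d : ℝ) + 1) ^ 2 * α₀' * (((((ℓ + 1) ^ i.k : ℕ) : ℝ)) ^ 2)⁻¹) * (M₂ * ∑ j, ‖b j‖) * A * 1
      = 32 * ((d : ℝ) + 1) ^ 2 * α₀' * (M₂ * ∑ j, ‖b j‖) * A := by
    have h1 := inv_etaS_sq_mul i
    calc (etaS i ^ 2)⁻¹ * (32 * ((d : ℝ) + 1) ^ 2 * α₀' * (((((ℓ + 1) ^ i.k : ℕ) : ℝ)) ^ 2)⁻¹) * (M₂ * ∑ j, ‖b j‖) * A * 1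
        = ((etaS i ^ 2)⁻¹ * (((((ℓ + 1) ^ i.k : ℕ) : ℝ)) ^ 2)⁻¹) * (32 * ((d : ℝ) + 1) ^ 2 * α₀') * (M₂ * ∑ j, ‖b j‖) * A := by ring
      _ = _ := by rw [h1]; ring
  have h := hasMajorant_conj_GpY_parKnitY_of_parSymY i b ιB hG hGa hU hα hα3 hα2 h52 hM₂ hrepr d' (P := fun a => (geo9K i).len a ^ 2) (Pmax := 1)
    hA (fun a => sq_nonneg _) (fun a => geo9K_len_sq_le_one i hcf a) hαδ htri hrefl hdnn h261 h263 (etaS_pos i).ne' (by rw [hθ]; exact hsmall) hGs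
  simpa only [hθ] using h

end Literature.MathematicalPhysics.QuantumFieldTheory.Balaban1983to89.B9B8KnitLetterMajorantTransfer

end
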